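import Mathlib
import Summits.KontsevichZagierPeriods.Zeta5Search.FamilyCellDDigits
import Summits.KontsevichZagierPeriods.Zeta5Search.RecordCellDProof
import HarnessLib

/-!
# ζ(5) search — FAMILY CELL D is a THEOREM: `v_p(Cas₇) ≥ −12` at `(t+3)n < 2p < (t+4)n` on every consecutive direction `n·(3t+8; t+6,…,t)`, `t ≥ 10`

Cell `pub-zeta5` (HONEST FRAMING: systematic search; no irrationality claim unless certified), P1 prover seat
generation 6.  Census g11 (`STRUCTURE §15.8`, typed as `CellAtlas.FamilyCellD`; OBSERVED 39/39 for `t = 10..20`; `t = 11` is the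
record cell D `RecordCellDProof`, `t = 12, 14` are NEAR-MISSES rows 2, 3): for `b = bFam t n`, `t ≥ 10`, `n ≥ 2` and a prime
`(t+3)n < 2p < (t+4)n` the tree proves `v_p(Cas₇(b)) ≥ −13`; this file proves **`v_p(Cas₇(b)) ≥ −12`** (`familyCellD`) — gen-2 g9's
THEOREM D-CELL (REPORT-gen2-g9 §8.3) for all `t ≥ 10` and all `n`.  Same `W`-row LB♯♯ assembly as `RecordCellDProof` with the
`t`-uniform atlas `FamilyCellDAtlas{,NotMin}` (`E_x ≥ −7` off the minimal classes) and digit layer `FamilyCellDDigits` (the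
minimal block now has a fourth part, the six-point palindromic classes `FMinP`, whose pair sums cancel like those of `FMinS`):
`A := p⁵W_M ≡ −αG`, `B := p⁸V_M ≡ βG (mod p)` for `b` and `b + e₇` with the record's symbolic constants, `A′B − AB′ ≡ 0`,
`p¹³·Cas₇ = (A′B − AB′) + p·(…) + p²·(…)`.  `familyCellD_holds : CellAtlas.FamilyCellD` BY NAME.  Valuations of rational numbers;
nothing about irrationality.  Exact cross-check: `code/p1/g6/famD_check.py` (8 instances, `t ∈ {10,…,17}`).
-/

noncomputable section

open Finset

namespace Summit.KontsevichZagierPeriods.Zeta5Search.CellD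

open Summit.KontsevichZagierPeriods.Zeta5Search.DualSeries (InBox)
open Summit.KontsevichZagierPeriods.Zeta5Search.WedgeDictionary (pfData coeffW coeffV)
open Summit.KontsevichZagierPeriods.Zeta5Search.CasoratianValuation (InPolytope shift casoratian)
open Summit.KontsevichZagierPeriods.Zeta5Search.ClusterValuation
open Summit.KontsevichZagierPeriods.Zeta5Search.PadicSeries
open Summit.KontsevichZagierPeriods.Zeta5Search.BigPrime (shift_zero padicNorm_mul_le_one)
open Summit.KontsevichZagierPeriods.Zeta5Search.CellAtlas (bFam)
open Summit.KontsevichZagierPeriods.Zeta5Search.CellA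
open Summit.KontsevichZagierPeriods.Zeta5Search.LevelClass

variable {p : ℕ} [hp : Fact p.Prime]

/-! ### §1 The two halves of `W` and `V`, the unit sum -/

/-- The minimal part of `W` (family). -/
def WMD (t n p : ℕ) (b : ℕ → ℤ) : ℚ := ∑ x ∈ FMinAllD t n p, classW b p x
/-- The rest of `W` (family). -/
def WRD (t n p : ℕ) (b : ℕ → ℤ) : ℚ := ∑ x ∈ range p \ FMinAllD t n p, classW b p x
/-- The minimal part of `V` (family). -/
def VMD (t n p : ℕ) (b : ℕ → ℤ) : ℚ := ∑ x ∈ FMinAllD t n p, classV b p x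
/-- The rest of `V` (family). -/
def VRD (t n p : ℕ) (b : ℕ → ℤ) : ℚ := ∑ x ∈ range p \ FMinAllD t n p, classV b p x
/-- The unit sum `G = Σ_{x ∈ FMinT1} ĝ_x` (family). -/
def GSD (t n p : ℕ) (b : ℕ → ℤ) : ℚ := ∑ x ∈ FMinT1 t n p, gHat b p x

omit hp in
/-- `W = W_M + W_R`. -/
theorem coeffW_splitD (t n : ℕ) {p : ℕ} (hp0 : 0 < p) (b : ℕ → ℤ) : coeffW b = WMD t n p b + WRD t n p b := by
  rw [coeffW_eq_sum_classW b hp0, WMD, WRD, ← sum_union disjoint_sdiff, union_sdiff_of_subset (fminAllD_subset t n p)]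

omit hp in
/-- `V = V_M + V_R`. -/
theorem coeffV_splitD (t n : ℕ) {p : ℕ} (hp0 : 0 < p) (b : ℕ → ℤ) : coeffV b = VMD t n p b + VRD t n p b := by
  rw [coeffV_eq_sum_classV b hp0, VMD, VRD, ← sum_union disjoint_sdiff, union_sdiff_of_subset (fminAllD_subset t n p)]

/-! ### §2 The minimal block: sums over `FMinAllD` and THE TWO CONGRUENCES -/

section MinBlock

variable {t n : ℕ} (ht : 10 ≤ t) (hp14 : t * n + 3 * n < 2 * p) (hp15 : 2 * p < t * n + 4 * n) (hp5 : 5 ≤ p)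
  (b : ℕ → ℤ) (hb : InPolytope b) (hwin : (b 0 + 2 : ℤ) < (p : ℤ) ^ 2) (hN : (b 0).toNat = 3 * (t * n) + 8 * n)
  (hcen : ∀ x, x < p → 2 * x + 4 * p ≠ 3 * (t * n) + 8 * n → 2 * x + 5 * p ≠ 3 * (t * n) + 8 * n → ¬ CentreIn b p x)
  (hT1 : ∀ x ∈ FMinT1 t n p, netExp b x = 1 ∧ netExp b (x + p) = -1 ∧ netExp b (x + 2 * p) = -6 ∧
      netExp b (x + 3 * p) = -3 ∧ netExp b (x + 4 * p) = 1)
  (hS : ∀ x ∈ FMinS t n p, netExp b x = 1 ∧ netExp b (x + p) = -2 ∧ netExp b (x + 2 * p) = -6 ∧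
      netExp b (x + 3 * p) = -2 ∧ netExp b (x + 4 * p) = 1)
  (hT2 : ∀ x ∈ FMinT2 t n p, netExp b x = 1 ∧ netExp b (x + p) = -3 ∧ netExp b (x + 2 * p) = -6 ∧
      netExp b (x + 3 * p) = -1 ∧ netExp b (x + 4 * p) = 1)
  (hP : ∀ x ∈ FMinP t n p, netExp b x = 1 ∧ netExp b (x + p) = 1 ∧ netExp b (x + 2 * p) = -6 ∧
      netExp b (x + 3 * p) = -6 ∧ netExp b (x + 4 * p) = 1 ∧ netExp b (x + 5 * p) = 1)

include ht in
omit hp in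
/-- A sum over `FMinT2` is the sum over `FMinT1` of the conjugates. -/
theorem sum_fminT2_eq (f : ℕ → ℚ) :
    ∑ x ∈ FMinT2 t n p, f x = ∑ x ∈ FMinT1 t n p, f (3 * (t * n) + 8 * n - (x + 4 * p)) := by
  have h10 : 10 * n ≤ t * n := Nat.mul_le_mul_right n ht
  refine (sum_nbij' (fun x => 3 * (t * n) + 8 * n - (x + 4 * p)) (fun x => 3 * (t * n) + 8 * n - (x + 4 * p))
    (fun x hx => conj_mem_fminT2 hx) (fun x hx => conj_mem_fminT1 ht hx) (fun x hx => ?_) (fun x hx => ?_)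
    (fun x hx => rfl)).symm
  · have := mem_fminT1.1 hx; omega
  · have := mem_fminT2.1 hx; omega

include ht hp14 in
omit hp in
/-- A sum over `FMinS` equals the sum of the conjugates. -/
theorem sum_fminS_conjD (f : ℕ → ℚ) :
    ∑ x ∈ FMinS t n p, f (3 * (t * n) + 8 * n - (x + 4 * p)) = ∑ x ∈ FMinS t n p, f x := by
  have h10 : 10 * n ≤ t * n := Nat.mul_le_mul_right n ht
  exact sum_nbij' (fun x => 3 * (t * n) + 8 * n - (x + 4 * p)) (fun x => 3 * (t * n) + 8 * n - (x + 4 * p))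
    (fun x hx => conj_mem_fminSD hp14 hx) (fun x hx => conj_mem_fminSD hp14 hx) (fun x hx => by have := mem_fminS'.1 hx; omega)
    (fun x hx => by have := mem_fminS'.1 hx; omega) (fun x hx => rfl)

include hp14 hp15 in
omit hp in
/-- A sum over `FMinP` equals the sum of the conjugates (`x ↦ N − (x+5p)`). -/
theorem sum_fminP_conj (f : ℕ → ℚ) :
    ∑ x ∈ FMinP t n p, f (3 * (t * n) + 8 * n - (x + 5 * p)) = ∑ x ∈ FMinP t n p, f x :=
  sum_nbij' (fun x => 3 * (t * n) + 8 * n - (x + 5 * p)) (fun x => 3 * (t * n) + 8 * n - (x + 5 * p))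
    (fun x hx => conj_mem_fminP hp14 hp15 hx) (fun x hx => conj_mem_fminP hp14 hp15 hx)
    (fun x hx => by have := mem_fminP.1 hx; omega) (fun x hx => by have := mem_fminP.1 hx; omega) (fun x hx => rfl)

include ht in
omit hp in
/-- Splitting a sum over `FMinAllD` into conjugate pairs of `FMinT1 ∪ FMinT2`, the classes of `FMinS` and those of `FMinP`. -/
theorem sum_fminAllD (f : ℕ → ℚ) : ∑ x ∈ FMinAllD t n p, f x =
    ∑ x ∈ FMinT1 t n p, (f x + f (3 * (t * n) + 8 * n - (x + 4 * p))) + ∑ x ∈ FMinS t n p, f x + ∑ x ∈ FMinP t n p, f x := by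
  rw [FMinAllD, sum_union (disjoint_fminT1ST2_fminP t n p), sum_union (disjoint_fminT1S_fminT2 t n p),
    sum_union (disjoint_fminT1_fminS t n p), sum_fminT2_eq ht, sum_add_distrib]
  ring

include ht hp14 hp15 hp5 hb hwin hN hcen hT1 hS hT2 hP in
/-- **The minimal block (family)**: `‖p⁵W_M‖ ≤ 1`, `‖p⁸V_M‖ ≤ 1`, `‖α·G‖ ≤ 1`, `‖G‖ ≤ 1`, and THE TWO CONGRUENCES
`p⁵W_M + α·G ≡ 0`, `p⁸V_M − β·G ≡ 0 (mod p)`. -/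
theorem minBlockF :
    padicNorm p ((p : ℚ) ^ 5 * WMD t n p b) ≤ 1 ∧ padicNorm p ((p : ℚ) ^ 8 * VMD t n p b) ≤ 1 ∧
    padicNorm p (alphaD * GSD t n p b) ≤ 1 ∧ padicNorm p (GSD t n p b) ≤ 1 ∧
    padicNorm p ((p : ℚ) ^ 5 * WMD t n p b + alphaD * GSD t n p b) ≤ (p : ℚ) ^ (-(1 : ℤ)) ∧
    padicNorm p ((p : ℚ) ^ 8 * VMD t n p b - betaD * GSD t n p b) ≤ (p : ℚ) ^ (-(1 : ℤ)) := by
  have PT := fun x (hx : x ∈ FMinT1 t n p) => packT1F ht hp14 hp15 hp5 b hb hwin hN hcen hT1 hT2 hx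
  have PS := fun x (hx : x ∈ FMinS t n p) => packSF ht hp14 hp15 hp5 b hb hwin hN hcen hS hx
  have PP := fun x (hx : x ∈ FMinP t n p) => packPF ht hp14 hp15 hp5 b hb hwin hN hcen hP hx
  refine ⟨?_, ?_, ?_, ?_, ?_, ?_⟩
  · rw [WMD, mul_sum, sum_fminAllD ht]
    refine nI_add (nI_add (padicNorm.sum_le' (fun x hx => ?_) zero_le_one) (padicNorm.sum_le' (fun x hx => ?_) zero_le_one))
      (padicNorm.sum_le' (fun x hx => ?_) zero_le_one)
    · obtain ⟨-, -, h1, -, h3, -, -, -⟩ := PT x hx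
      exact nI_add h1 h3
    · exact (PS x hx).2.2.1
    · exact (PP x hx).2.2.1
  · rw [VMD, mul_sum, sum_fminAllD ht]
    refine nI_add (nI_add (padicNorm.sum_le' (fun x hx => ?_) zero_le_one) (padicNorm.sum_le' (fun x hx => ?_) zero_le_one))
      (padicNorm.sum_le' (fun x hx => ?_) zero_le_one)
    · obtain ⟨-, -, -, h2, -, h4, -, -⟩ := PT x hx
      exact nI_add h2 h4
    · exact (PS x hx).2.2.2
    · exact (PP x hx).2.2.2
  · rw [GSD, mul_sum]
    exact padicNorm.sum_le' (fun x hx => padicNorm_mul_le_one (PT x hx).2.2.2.2.2.2.1 (PT x hx).2.2.2.2.2.2.2) zero_le_one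
  · rw [GSD]
    exact padicNorm.sum_le' (fun x hx => (PT x hx).2.2.2.2.2.2.2) zero_le_one
  · have e : (p : ℚ) ^ 5 * WMD t n p b + alphaD * GSD t n p b =
        ∑ x ∈ FMinT1 t n p, ((p : ℚ) ^ 5 * (classW b p x + classW b p (3 * (t * n) + 8 * n - (x + 4 * p))) +
          alphaD * gHat b p x) +
        (∑ x ∈ FMinS t n p, (p : ℚ) ^ 5 * classW b p x + ∑ x ∈ FMinP t n p, (p : ℚ) ^ 5 * classW b p x) := by
      have h1 : ∑ x ∈ FMinT1 t n p, ((p : ℚ) ^ 5 * (classW b p x + classW b p (3 * (t * n) + 8 * n - (x + 4 * p))) +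
            alphaD * gHat b p x) =
          ∑ x ∈ FMinT1 t n p, ((p : ℚ) ^ 5 * classW b p x + (p : ℚ) ^ 5 * classW b p (3 * (t * n) + 8 * n - (x + 4 * p))) +
            ∑ x ∈ FMinT1 t n p, alphaD * gHat b p x := by
        rw [← sum_add_distrib]; exact sum_congr rfl (fun x _ => by ring)
      rw [WMD, mul_sum, sum_fminAllD ht, GSD, mul_sum, h1]; ring
    rw [e]
    refine small_add (padicNorm.sum_le' (fun x hx => (PT x hx).1) (zpow_p_nonneg _))
      (small_add (small_of_two_mul hp5 ?_) (small_of_two_mul hp5 ?_))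
    · have e2 : (2 : ℚ) * ∑ x ∈ FMinS t n p, (p : ℚ) ^ 5 * classW b p x =
          ∑ x ∈ FMinS t n p, (p : ℚ) ^ 5 * (classW b p x + classW b p (3 * (t * n) + 8 * n - (x + 4 * p))) := by
        rw [two_mul, sum_congr rfl fun x _ => mul_add _ _ _, sum_add_distrib,
          sum_fminS_conjD ht hp14 (fun x => (p : ℚ) ^ 5 * classW b p x)]
      rw [e2]
      exact padicNorm.sum_le' (fun x hx => (PS x hx).1) (zpow_p_nonneg _)
    · have e2 : (2 : ℚ) * ∑ x ∈ FMinP t n p, (p : ℚ) ^ 5 * classW b p x =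
          ∑ x ∈ FMinP t n p, (p : ℚ) ^ 5 * (classW b p x + classW b p (3 * (t * n) + 8 * n - (x + 5 * p))) := by
        rw [two_mul, sum_congr rfl fun x _ => mul_add _ _ _, sum_add_distrib,
          sum_fminP_conj hp14 hp15 (fun x => (p : ℚ) ^ 5 * classW b p x)]
      rw [e2]
      exact padicNorm.sum_le' (fun x hx => (PP x hx).1) (zpow_p_nonneg _)
  · have e : (p : ℚ) ^ 8 * VMD t n p b - betaD * GSD t n p b =
        ∑ x ∈ FMinT1 t n p, ((p : ℚ) ^ 8 * (classV b p x + classV b p (3 * (t * n) + 8 * n - (x + 4 * p))) -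
          betaD * gHat b p x) +
        (∑ x ∈ FMinS t n p, (p : ℚ) ^ 8 * classV b p x + ∑ x ∈ FMinP t n p, (p : ℚ) ^ 8 * classV b p x) := by
      have h1 : ∑ x ∈ FMinT1 t n p, ((p : ℚ) ^ 8 * (classV b p x + classV b p (3 * (t * n) + 8 * n - (x + 4 * p))) -
            betaD * gHat b p x) =
          ∑ x ∈ FMinT1 t n p, ((p : ℚ) ^ 8 * classV b p x + (p : ℚ) ^ 8 * classV b p (3 * (t * n) + 8 * n - (x + 4 * p))) -
            ∑ x ∈ FMinT1 t n p, betaD * gHat b p x := by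
        rw [← sum_sub_distrib]; exact sum_congr rfl (fun x _ => by ring)
      rw [VMD, mul_sum, sum_fminAllD ht, GSD, mul_sum, h1]; ring
    rw [e]
    refine small_add (padicNorm.sum_le' (fun x hx => (PT x hx).2.1) (zpow_p_nonneg _))
      (small_add (small_of_two_mul hp5 ?_) (small_of_two_mul hp5 ?_))
    · have e2 : (2 : ℚ) * ∑ x ∈ FMinS t n p, (p : ℚ) ^ 8 * classV b p x =
          ∑ x ∈ FMinS t n p, (p : ℚ) ^ 8 * (classV b p x + classV b p (3 * (t * n) + 8 * n - (x + 4 * p))) := by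
        rw [two_mul, sum_congr rfl fun x _ => mul_add _ _ _, sum_add_distrib,
          sum_fminS_conjD ht hp14 (fun x => (p : ℚ) ^ 8 * classV b p x)]
      rw [e2]
      exact padicNorm.sum_le' (fun x hx => (PS x hx).2.1) (zpow_p_nonneg _)
    · have e2 : (2 : ℚ) * ∑ x ∈ FMinP t n p, (p : ℚ) ^ 8 * classV b p x =
          ∑ x ∈ FMinP t n p, (p : ℚ) ^ 8 * (classV b p x + classV b p (3 * (t * n) + 8 * n - (x + 5 * p))) := by
        rw [two_mul, sum_congr rfl fun x _ => mul_add _ _ _, sum_add_distrib,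
          sum_fminP_conj hp14 hp15 (fun x => (p : ℚ) ^ 8 * classV b p x)]
      rw [e2]
      exact padicNorm.sum_le' (fun x hx => (PP x hx).2.1) (zpow_p_nonneg _)

end MinBlock

/-! ### §3 The rest: `‖W_R‖ ≤ p⁴`, `‖V_R‖ ≤ p⁷` for `b` and `b + e₇` -/

section Rest

variable {t n : ℕ} (ht : 10 ≤ t) (hn : 1 ≤ n) (hp14 : t * n + 3 * n < 2 * p) (hp15 : 2 * p < t * n + 4 * n) (hp5 : 5 ≤ p)

include ht hp14 hp15 hp5 in
/-- The class data of `b` on the non-minimal classes: `E_x ≥ −7`, `ν_x ≥ −7`. -/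
theorem rest_dataF {x : ℕ} (hx : x ∈ range p \ FMinAllD t n p) :
    x < p ∧ (1 ≤ classPoleCount (bFam t n) p x → -7 ≤ classNu (bFam t n) p x) ∧
      (2 ≤ classPoleCount (bFam t n) p x → -7 ≤ classExp (bFam t n) p x) := by
  rw [mem_sdiff, mem_range, FMinAllD, mem_union, mem_union, mem_union, not_or, not_or, not_or] at hx
  obtain ⟨hxp, ⟨⟨h1, h2⟩, h3⟩, h4⟩ := hx
  have hodd : ¬ 2 ∣ p := fun h => by
    have := (Nat.prime_dvd_prime_iff_eq Nat.prime_two hp.out).1 h; omega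
  exact ⟨hxp, fun _ => classNuF_ge_of_notMin ht hp14 hp15 hxp hodd h1 h2 h3 h4,
    fun _ => classExpF_ge_of_notMin ht hp14 hp15 hxp hodd h1 h2 h3 h4⟩

include ht hp14 hp15 hp5 in
/-- **`‖W_R(b)‖ ≤ p⁴` and `‖V_R(b)‖ ≤ p⁷`.** -/
theorem rest_bFamD : padicNorm p (WRD t n p (bFam t n)) ≤ (p : ℚ) ^ (4 : ℤ) ∧
    padicNorm p (VRD t n p (bFam t n)) ≤ (p : ℚ) ^ (7 : ℤ) := by
  have h10 : 10 * n ≤ t * n := Nat.mul_le_mul_right n ht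
  have hb := inPolytope_bFam (show 4 ≤ t by omega) n
  have hwin : (bFam t n 0 + 2 : ℤ) < (p : ℤ) ^ 2 := by
    rw [bFam_val0]; push_cast
    have : ((10 * n : ℕ) : ℤ) ≤ ((t * n : ℕ) : ℤ) := by exact_mod_cast h10
    push_cast at this; nlinarith
  refine ⟨padicNorm.sum_le' (fun x hx => ?_) (zpow_p_nonneg _), padicNorm.sum_le' (fun x hx => ?_) (zpow_p_nonneg _)⟩
  · obtain ⟨-, -, hE⟩ := rest_dataF ht hp14 hp15 hp5 hx
    have := padicNorm_classW_le (m := -7) _ hb hp5 hwin (by norm_num) hE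
    norm_num at this; exact this
  · obtain ⟨hxp, hν, -⟩ := rest_dataF ht hp14 hp15 hp5 hx
    have := padicNorm_classV_le_of (v := -7) _ hb hp5 hwin hxp hν
    norm_num at this; exact this

include ht hn hp14 hp15 hp5 in
/-- **`‖W_R(b+e₇)‖ ≤ p⁴` and `‖V_R(b+e₇)‖ ≤ p⁷`** (shift monotonicity of the class data). -/
theorem rest_shiftFD : padicNorm p (WRD t n p (shift (bFam t n) 7)) ≤ (p : ℚ) ^ (4 : ℤ) ∧
    padicNorm p (VRD t n p (shift (bFam t n) 7)) ≤ (p : ℚ) ^ (7 : ℤ) := by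
  have h10 : 10 * n ≤ t * n := Nat.mul_le_mul_right n ht
  have hb := inPolytope_bFam (show 4 ≤ t by omega) n
  have hb' := inPolytope_shift_bFam (show 4 ≤ t by omega) hn
  have hwin : (bFam t n 0 + 2 : ℤ) < (p : ℤ) ^ 2 := by
    rw [bFam_val0]; push_cast
    have : ((10 * n : ℕ) : ℤ) ≤ ((t * n : ℕ) : ℤ) := by exact_mod_cast h10
    push_cast at this; nlinarith
  have hwin' : (shift (bFam t n) 7 0 + 2 : ℤ) < (p : ℤ) ^ 2 := by rw [shift_zero _ (by norm_num)]; exact hwin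
  have hcnt : ∀ x, classPoleCount (shift (bFam t n) 7) p x ≤ classPoleCount (bFam t n) p x :=
    fun x => classPoleCount_shift_le _ hb.1 (by norm_num) p x
  refine ⟨padicNorm.sum_le' (fun x hx => ?_) (zpow_p_nonneg _), padicNorm.sum_le' (fun x hx => ?_) (zpow_p_nonneg _)⟩
  · obtain ⟨-, -, hE⟩ := rest_dataF ht hp14 hp15 hp5 hx
    have := padicNorm_classW_le (m := -7) _ hb' hp5 hwin' (by norm_num) fun h2 =>
      (hE (h2.trans (hcnt x))).trans (classExp_shift_ge _ hb.1 (by norm_num) p x)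
    norm_num at this; exact this
  · obtain ⟨hxp, hν, -⟩ := rest_dataF ht hp14 hp15 hp5 hx
    have := padicNorm_classV_le_of (v := -7) _ hb' hp5 hwin' hxp fun h1 =>
      (hν (h1.trans (hcnt x))).trans (classNu_shift_ge _ hb.1 (by norm_num) h1)
    norm_num at this; exact this

end Rest

/-! ### §4 FAMILY CELL D -/

/-- **FAMILY CELL D (census g11) is a THEOREM.**  For `t ≥ 10`, `n ≥ 2` and every prime `(t+3)n < 2p < (t+4)n`:
`v_p(W(b⁺)V(b) − W(b)V(b⁺)) ≥ −12` for `b = n·(3t+8; t+6,…,t)`, `b⁺ = b + e₇` (tree/THEOREM LB: `−13`; census: equality at all 39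
instances `t = 10..20`).  Literally the statement `CellAtlas.FamilyCellD`; `t = 11` is `RecordCellD`. -/
theorem familyCellD : ∀ t n p : ℕ, 10 ≤ t → 2 ≤ n → p.Prime → (t + 3) * n < 2 * p → 2 * p < (t + 4) * n →
    casoratian (bFam t n) 7 ≠ 0 → (-12 : ℤ) ≤ padicValRat p (casoratian (bFam t n) 7) := by
  intro t n p ht hn2 hprime hp14' hp15' hne
  haveI : Fact p.Prime := ⟨hprime⟩
  have hp14 : t * n + 3 * n < 2 * p := by rw [Nat.add_mul] at hp14'; exact hp14'
  have hp15 : 2 * p < t * n + 4 * n := by rw [Nat.add_mul] at hp15'; exact hp15'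
  have h10 : 10 * n ≤ t * n := Nat.mul_le_mul_right n ht
  have hn : 1 ≤ n := by omega
  have hp5 : 5 ≤ p := by omega
  set b := bFam t n with hbdef
  set b' := shift (bFam t n) 7 with hb'def
  have hb : InPolytope b := inPolytope_bFam (show 4 ≤ t by omega) n
  have hb' : InPolytope b' := inPolytope_shift_bFam (show 4 ≤ t by omega) hn
  have hwin : (b 0 + 2 : ℤ) < (p : ℤ) ^ 2 := by
    rw [hbdef, bFam_val0]; push_cast
    have : ((10 * n : ℕ) : ℤ) ≤ ((t * n : ℕ) : ℤ) := by exact_mod_cast h10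
    push_cast at this; nlinarith
  have hwin' : (b' 0 + 2 : ℤ) < (p : ℤ) ^ 2 := by rw [hb'def, shift_zero _ (by norm_num)]; exact hwin
  have hN : (b 0).toNat = 3 * (t * n) + 8 * n := bFam_zero_toNat t n
  have hN' : (b' 0).toNat = 3 * (t * n) + 8 * n := shiftF7_zero_toNat t n
  have hcen : ∀ x, x < p → 2 * x + 4 * p ≠ 3 * (t * n) + 8 * n → 2 * x + 5 * p ≠ 3 * (t * n) + 8 * n →
      ¬ CentreIn b p x := fun x hx h4 h5 => not_centreInF ht hp14 hp15 hx h4 h5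
  have hcen' : ∀ x, x < p → 2 * x + 4 * p ≠ 3 * (t * n) + 8 * n → 2 * x + 5 * p ≠ 3 * (t * n) + 8 * n →
      ¬ CentreIn b' p x :=
    fun x hx h4 h5 h => not_centreInF ht hp14 hp15 hx h4 h5 ((centreIn_shift (bFam t n) (by norm_num : 1 ≤ 7) p x).1 h)
  have hT1 := fun x (hx : x ∈ FMinT1 t n p) => (netExp_fminT1 ht hp14 hp15 hx).1
  have hS := fun x (hx : x ∈ FMinS t n p) => (netExp_fminSD ht hp14 hp15 hx).1
  have hT2 := fun x (hx : x ∈ FMinT2 t n p) => (netExp_fminT2 ht hp14 hp15 hx).1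
  have hP := fun x (hx : x ∈ FMinP t n p) => (netExp_fminP ht hp14 hp15 hx).1
  have hT1' := fun x (hx : x ∈ FMinT1 t n p) => (netExp_fminT1 ht hp14 hp15 hx).2.1
  have hS' := fun x (hx : x ∈ FMinS t n p) => (netExp_fminSD ht hp14 hp15 hx).2.1
  have hT2' := fun x (hx : x ∈ FMinT2 t n p) => (netExp_fminT2 ht hp14 hp15 hx).2.1
  have hP' := fun x (hx : x ∈ FMinP t n p) => (netExp_fminP ht hp14 hp15 hx).2.1
  -- the bounded quantities
  set A := (p : ℚ) ^ 5 * WMD t n p b with hAdef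
  set A' := (p : ℚ) ^ 5 * WMD t n p b' with hA'def
  set B := (p : ℚ) ^ 8 * VMD t n p b with hBdef
  set B' := (p : ℚ) ^ 8 * VMD t n p b' with hB'def
  set G := GSD t n p b with hGdef
  set G' := GSD t n p b' with hG'def
  set C := (p : ℚ) ^ 7 * VRD t n p b with hCdef
  set C' := (p : ℚ) ^ 7 * VRD t n p b' with hC'def
  set R := (p : ℚ) ^ 4 * WRD t n p b with hRdef
  set R' := (p : ℚ) ^ 4 * WRD t n p b' with hR'def
  obtain ⟨iA, iB, iαG, iG, cA, cB⟩ := minBlockF ht hp14 hp15 hp5 b hb hwin hN hcen hT1 hS hT2 hP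
  obtain ⟨iA', iB', iαG', iG', cA', cB'⟩ := minBlockF ht hp14 hp15 hp5 b' hb' hwin' hN' hcen' hT1' hS' hT2' hP'
  obtain ⟨iWR, iVR⟩ := rest_bFamD (p := p) ht hp14 hp15 hp5
  obtain ⟨iWR', iVR'⟩ := rest_shiftFD (p := p) ht hn hp14 hp15 hp5
  have iR : padicNorm p R ≤ 1 := nI_scale iWR
  have iR' : padicNorm p R' ≤ 1 := nI_scale iWR'
  have iC : padicNorm p C ≤ 1 := nI_scale iVR
  have iC' : padicNorm p C' ≤ 1 := nI_scale iVR'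
  -- the key congruence `A′B ≡ AB′`
  have key : padicNorm p (A' * B - A * B') ≤ (p : ℚ) ^ (-(1 : ℤ)) := by
    have e : A' * B - A * B' =
        (A' + alphaD * G') * B - alphaD * G' * (B - betaD * G) - (A + alphaD * G) * B' + alphaD * G * (B' - betaD * G') := by
      ring
    rw [e]
    exact small_add (small_sub (small_sub (by rw [mul_comm]; exact small_mul iB cA') (small_mul iαG' cB))
      (by rw [mul_comm]; exact small_mul iB' cA)) (small_mul iαG cB')
  -- the identity
  have hp0 : (p : ℚ) ≠ 0 := Nat.cast_ne_zero.2 hprime.ne_zero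
  have hW : coeffW b = A / (p : ℚ) ^ 5 + R / (p : ℚ) ^ 4 := by
    rw [coeffW_splitD t n hprime.pos b, hAdef, hRdef]; field_simp
  have hW' : coeffW b' = A' / (p : ℚ) ^ 5 + R' / (p : ℚ) ^ 4 := by
    rw [coeffW_splitD t n hprime.pos b', hA'def, hR'def]; field_simp
  have hV : coeffV b = B / (p : ℚ) ^ 8 + C / (p : ℚ) ^ 7 := by
    rw [coeffV_splitD t n hprime.pos b, hBdef, hCdef]; field_simp
  have hV' : coeffV b' = B' / (p : ℚ) ^ 8 + C' / (p : ℚ) ^ 7 := by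
    rw [coeffV_splitD t n hprime.pos b', hB'def, hC'def]; field_simp
  have e : (p : ℚ) ^ 13 * casoratian b 7 =
      (A' * B - A * B') + p * (A' * C + R' * B - A * C' - R * B') + (p : ℚ) ^ 2 * (R' * C - R * C') := by
    rw [casoratian, ← hb'def, hW, hW', hV, hV']
    field_simp
    ring
  -- the bound `‖p¹³·Cas‖ ≤ p⁻¹`
  have ip : padicNorm p (p : ℚ) ≤ 1 := nI_nat p
  have h13 : padicNorm p ((p : ℚ) ^ 13 * casoratian b 7) ≤ (p : ℚ) ^ (-(1 : ℤ)) := by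
    rw [e]
    refine small_add (small_add key (small_p_mul ?_)) ?_
    · exact nI_sub (nI_sub (nI_add (padicNorm_mul_le_one iA' iC) (padicNorm_mul_le_one iR' iB))
        (padicNorm_mul_le_one iA iC')) (padicNorm_mul_le_one iR iB')
    · rw [pow_two, mul_assoc]
      exact small_mul ip (small_p_mul (nI_sub (padicNorm_mul_le_one iR' iC) (padicNorm_mul_le_one iR iC')))
  -- unscale
  apply val_ge_of_padicNorm_le hne
  have hp13n : padicNorm p ((p : ℚ) ^ 13) = ((p : ℚ) ^ 13)⁻¹ := padicNorm_p_pow 13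
  have hpos : (0 : ℚ) < (p : ℚ) ^ 13 := pow_pos (by exact_mod_cast hprime.pos) 13
  rw [padicNorm.mul, hp13n, inv_mul_le_iff₀ hpos] at h13
  refine h13.trans (le_of_eq ?_)
  rw [neg_neg, ← zpow_natCast, ← zpow_add₀ hp0]
  norm_num

/-- **`CellAtlas.FamilyCellD` (census g11) is a THEOREM** — discharged by name. -/
theorem familyCellD_holds : CellAtlas.FamilyCellD := familyCellD

end Summit.KontsevichZagierPeriods.Zeta5Search.CellD

end
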